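import Summits.QuantumFields.YangMills.Theorems.VirialFluxGapScalingTauber
import HarnessLib

/-!
# Route `VirialFluxGap` (YangMills): the ROBUST one-sided Tauberian mean bound — an ALMOST-monotone scaling law suffices

Sequel to ✓`ScalingTauber.scalingTauber` (crux ⟨stmt-QuantumFields-24141⟩ `VirialFluxGap.PeriodicSoftness`, volume route).  The SHARP law
`θ^α m(t) ≤ m(θt)` (all `θ ∈ (0,1]`) is flow output; an EXPLICIT quasi-homogeneous contraction map (`√θ` on the massive modes, `θ^{1/4}` on the
twelve toron zero modes, identity along the gauge orbit) only yields the ROBUST law `(1 − η)·θ^α·m(t) ≤ m(θt)`, `η = poly(L)·t₀^{1/4}` (design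
note of width seat w3 g58, 2026-08-30).  ★ `scalingTauber_robust`: the robust law + floor `m₁ ≤ m(t₀)` + threshold
`(βt₀+1)(βt₀)^α e^{2−βt₀} ≤ ε(1−η)m₁` ⟹ `β⟨F⟩_β ≤ α + ε + η(1+α)/(1−η)`.  Proof: with `n(s) = s^{−α}m(s)` the robust law is
`(1−η)n(y) ≤ n(x)` (`0 < x ≤ y ≤ t₀`); its least antitone MAJORANT `N(x) = sup_{[x,t₀]} n` has `n ≤ N ≤ n/(1−η)`; run ✓`scalingTauber`'s
argument with the antitone factor `N·𝟙_{(0,t₀]}` in Chebyshev's inequality (Gamma first moment `0`) and pay the defect only where `βs < 1+α`: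
`(βs−1−α)(n−N) ≤ (1+α)(N−n) ≤ (1+α)η/(1−η)·n`.  With `α = 9L⁴ − c` one needs `η ≲ c/L⁴` — affordable, `t₀ = 1/poly(L)` being free.

HONEST FRAMING: generic real analysis; no stub / crux / rung / summit is closed by this file; ⟨24141⟩ stays OPEN; the Yang–Mills mass gap is
NOT proved.  THEOREMS ONLY (0 `def`, 0 `sorry`), standard axioms.  Width seat `ym-line-sfw-p2-w2` g51, `--supports stmt-QuantumFields-24141`.
References: [cite: Griffiths1964]; [cite: TomboulisYaffe1985].
-/

set_option autoImplicit false

noncomputable section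

open MeasureTheory Set Filter Real
open scoped Topology
open Summit.QuantumFields.YangMills.Theorems.VirialFluxGap.TauberWeights
open Summit.QuantumFields.YangMills.Theorems.VirialFluxGap.TauberMeanUpperPrep
open Summit.QuantumFields.YangMills.Theorems.VirialFluxGap.LaplaceLayerCake

namespace Summit.QuantumFields.YangMills.Theorems.VirialFluxGap.ScalingTauber

/-! ## §1 The robust law in normalised form, and the antitone majorant -/

/-- The robust law propagates downward in normalised form: `(1−η)·y^{−α}m(y) ≤ x^{−α}m(x)` for `0 < x ≤ y ≤ t₀`. [folklore] -/
theorem rpow_neg_mul_robust {m : ℝ → ℝ} {α t₀ η x y : ℝ} (hx : 0 < x) (hxy : x ≤ y) (hy : y ≤ t₀)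
    (hscal : ∀ t : ℝ, 0 < t → t ≤ t₀ → ∀ θ : ℝ, 0 < θ → θ ≤ 1 → (1 - η) * (θ ^ α * m t) ≤ m (θ * t)) :
    (1 - η) * (y ^ (-α) * m y) ≤ x ^ (-α) * m x := by
  have hy0 : 0 < y := lt_of_lt_of_le hx hxy
  have hθ0 : 0 < x / y := div_pos hx hy0
  have hθ1 : x / y ≤ 1 := (div_le_one hy0).mpr hxy
  have h := hscal y hy0 hy (x / y) hθ0 hθ1
  rw [div_mul_cancel₀ x hy0.ne'] at h
  have hxα : 0 < x ^ α := Real.rpow_pos_of_pos hx α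
  have e1 : (x / y) ^ α = x ^ α * y ^ (-α) := by
    rw [Real.div_rpow hx.le hy0.le, Real.rpow_neg hy0.le, div_eq_mul_inv]
  have hxnα : x ^ (-α) = (x ^ α)⁻¹ := Real.rpow_neg hx.le α
  calc (1 - η) * (y ^ (-α) * m y) = (x ^ α)⁻¹ * ((1 - η) * ((x / y) ^ α * m y)) := by
        rw [e1]; field_simp
    _ ≤ (x ^ α)⁻¹ * m x := mul_le_mul_of_nonneg_left h (inv_nonneg.mpr hxα.le)
    _ = x ^ (-α) * m x := by rw [hxnα]

/-! ## §2 The robust one-sided Tauberian mean bound -/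

/-- ★★★ **Robust scaling Tauberian bound.**  On a probability space let `F ≥ 0` be measurable with volume function `m(t) = μ{F ≤ t}`; assume
the ROBUST SCALING LAW `(1−η)·θ^α·m(t) ≤ m(θt)` (`0 < θ ≤ 1`, `0 < t ≤ t₀`, `0 ≤ η < 1`), a floor `m₁ ≤ m(t₀)`, `α ≥ 1`, `2 ≤ βt₀`, and the
threshold `(βt₀+1)(βt₀)^α e^{2−βt₀} ≤ ε(1−η)m₁`.  Then `β·∫F e^{−βF}dμ / ∫e^{−βF}dμ ≤ α + ε + η(1+α)/(1−η)`.
No crux / rung / summit is proved; the YM mass gap is NOT proved. [cite: Griffiths1964] [cite: TomboulisYaffe1985] -/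
theorem scalingTauber_robust {Ω : Type*} [MeasurableSpace Ω] (μ : Measure Ω) [IsProbabilityMeasure μ] {F : Ω → ℝ}
    (hF : Measurable F) (hF0 : ∀ ω, 0 ≤ F ω) {α t₀ m₁ ε η β : ℝ}
    (hα : 1 ≤ α) (ht₀ : 0 < t₀) (hm₁ : 0 < m₁) (hε : 0 < ε) (hη0 : 0 ≤ η) (hη1 : η < 1) (hβ : 0 < β) (hβt : 2 ≤ β * t₀)
    (hfloor : m₁ ≤ μ.real {ω | F ω ≤ t₀})
    (hscal : ∀ t : ℝ, 0 < t → t ≤ t₀ → ∀ θ : ℝ, 0 < θ → θ ≤ 1 →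
      (1 - η) * (θ ^ α * μ.real {ω | F ω ≤ t}) ≤ μ.real {ω | F ω ≤ θ * t})
    (hthr : (β * t₀ + 1) * (β * t₀) ^ α * Real.exp (2 - β * t₀) ≤ ε * ((1 - η) * m₁)) :
    β * (∫ ω, F ω * Real.exp (-(β * F ω)) ∂μ) / (∫ ω, Real.exp (-(β * F ω)) ∂μ) ≤ α + ε + η * (1 + α) / (1 - η) := by
  have hα0 : 0 < α := by linarith
  have hαm1 : -1 < α := by linarith
  have h1η : 0 < 1 - η := by linarith
  set η' : ℝ := η * (1 + α) / (1 - η) with hη'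
  have hη'0 : 0 ≤ η' := by positivity
  set A : ℝ := 1 + α + (ε + η') with hA
  have hA0 : 0 ≤ A := by positivity
  have hA1 : 0 ≤ 1 + α := by positivity
  have h2β : 2 / β ≤ t₀ := by rw [div_le_iff₀ hβ]; linarith
  set m : ℝ → ℝ := fun s => μ.real {ω | F ω ≤ s} with hm
  set n : ℝ → ℝ := fun s => s ^ (-α) * m s with hn_def
  set hn : ℝ → ℝ := (Iic t₀).indicator n with hhn
  set N : ℝ → ℝ := fun x => sSup (n '' Icc x t₀) with hN
  set h : ℝ → ℝ := (Ioc 0 t₀).indicator N with hh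
  set g : ℝ → ℝ := fun s => β * Real.exp (-(β * s)) * s ^ α with hg
  have hm_mono : Monotone m := fun s s' hss' => measureReal_mono (fun ω (hω : F ω ≤ s) => hω.trans hss')
  have hm_meas : Measurable m := hm_mono.measurable
  have hm0 : ∀ s, 0 ≤ m s := fun s => measureReal_nonneg
  have hm1 : ∀ s, m s ≤ 1 := fun s => (measureReal_mono (subset_univ _)).trans (le_of_eq probReal_univ)
  have hn0 : ∀ s, 0 < s → 0 ≤ n s := fun s hs => mul_nonneg (Real.rpow_nonneg hs.le _) (hm0 s)
  have hrob : ∀ x y : ℝ, 0 < x → x ≤ y → y ≤ t₀ → (1 - η) * n y ≤ n x := fun x y hx hxy hy =>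
    rpow_neg_mul_robust (m := m) hx hxy hy hscal
  have hrob' : ∀ x y : ℝ, 0 < x → x ≤ y → y ≤ t₀ → n y ≤ n x / (1 - η) := fun x y hx hxy hy => by
    rw [le_div_iff₀ h1η, mul_comm]; exact hrob x y hx hxy hy
  have hbdd : ∀ x, 0 < x → BddAbove (n '' Icc x t₀) := fun x hx =>
    ⟨n x / (1 - η), by rintro _ ⟨y, hy, rfl⟩; exact hrob' x y hx hy.1 hy.2⟩
  have hne : ∀ x, x ≤ t₀ → (n '' Icc x t₀).Nonempty := fun x hx => ⟨n x, mem_image_of_mem n ⟨le_rfl, hx⟩⟩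
  have hnN : ∀ x, 0 < x → x ≤ t₀ → n x ≤ N x := fun x hx hxt => le_csSup (hbdd x hx) (mem_image_of_mem n ⟨le_rfl, hxt⟩)
  have hNn : ∀ x, 0 < x → x ≤ t₀ → N x ≤ n x / (1 - η) := fun x hx hxt =>
    csSup_le (hne x hxt) (by rintro _ ⟨y, hy, rfl⟩; exact hrob' x y hx hy.1 hy.2)
  -- `h`: antitone on `(0,∞)`, non-negative, sandwiched
  have hh_in : ∀ s, 0 < s → s ≤ t₀ → h s = N s := fun s hs hst => by rw [hh, indicator_of_mem (mem_Ioc.mpr ⟨hs, hst⟩)]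
  have hh_out : ∀ s, ¬ s ≤ t₀ → h s = 0 := fun s hst => by rw [hh, indicator_of_notMem (fun h => hst (mem_Ioc.mp h).2)]
  have hh_nonneg : ∀ s, 0 < s → 0 ≤ h s := fun s hs => by
    by_cases hst : s ≤ t₀
    · rw [hh_in s hs hst]; exact (hn0 s hs).trans (hnN s hs hst)
    · rw [hh_out s hst]
  have hh_anti : AntitoneOn h (Ioi 0) := by
    intro x hx y hy hxy
    have hx0 : (0 : ℝ) < x := hx
    have hy0 : (0 : ℝ) < y := hy
    by_cases hyt : y ≤ t₀
    · have hxt : x ≤ t₀ := hxy.trans hyt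
      rw [hh_in x hx0 hxt, hh_in y hy0 hyt]
      exact csSup_le_csSup (hbdd x hx0) (hne y hyt) (Set.image_mono (Icc_subset_Icc hxy le_rfl))
    · rw [hh_out y hyt]; exact hh_nonneg x hx0
  have hhn_in : ∀ s, s ≤ t₀ → hn s = n s := fun s hst => by rw [hhn, indicator_of_mem (mem_Iic.mpr hst)]
  have hhn_out : ∀ s, ¬ s ≤ t₀ → hn s = 0 := fun s hst => by rw [hhn, indicator_of_notMem (fun h => hst (mem_Iic.mp h))]
  have hhn_le_h : ∀ s, 0 < s → hn s ≤ h s := fun s hs => by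
    by_cases hst : s ≤ t₀
    · rw [hhn_in s hst, hh_in s hs hst]; exact hnN s hs hst
    · rw [hhn_out s hst, hh_out s hst]
  have hh_le_hn : ∀ s, 0 < s → h s ≤ hn s / (1 - η) := fun s hs => by
    by_cases hst : s ≤ t₀
    · rw [hhn_in s hst, hh_in s hs hst]; exact hNn s hs hst
    · rw [hhn_out s hst, hh_out s hst, zero_div]
  have hhn_nonneg : ∀ s, 0 < s → 0 ≤ hn s := fun s hs => by
    by_cases hst : s ≤ t₀
    · rw [hhn_in s hst]; exact hn0 s hs
    · rw [hhn_out s hst]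
  have hhnm : Measurable hn := ((measurable_id.pow_const (-α)).mul hm_meas).indicator measurableSet_Iic
  have hh_floor : ∀ s, 0 < s → s ≤ t₀ → (1 - η) * (t₀ ^ (-α) * m₁) ≤ hn s := fun s hs hst => by
    rw [hhn_in s hst]
    calc (1 - η) * (t₀ ^ (-α) * m₁) ≤ (1 - η) * (t₀ ^ (-α) * m t₀) :=
          mul_le_mul_of_nonneg_left (mul_le_mul_of_nonneg_left hfloor (Real.rpow_nonneg ht₀.le _)) h1η.le
      _ ≤ n s := hrob s t₀ hs hst le_rfl
  have hgm : Measurable g :=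
    (measurable_const.mul (measurable_const.mul measurable_id).neg.exp).mul (measurable_id.pow_const α)
  have hgi : IntegrableOn g (Ioi 0) := integrableOn_weight hβ hαm1
  have hg_nonneg : ∀ s ∈ Ioi (0:ℝ), 0 ≤ g s := fun s hs => by
    rw [hg]; have := Real.rpow_nonneg (le_of_lt (hs : (0:ℝ) < s)) α; positivity
  have hG0 : 0 < ∫ s in Ioi (0:ℝ), g s := by rw [hg]; exact integral_weight_pos hβ hαm1
  have hghn : ∀ s, 0 < s → g s * hn s = (Iic t₀).indicator (fun s => β * Real.exp (-(β * s)) * m s) s := fun s hs => by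
    by_cases hst : s ≤ t₀
    · rw [hhn_in s hst, indicator_of_mem (mem_Iic.mpr hst), hg, hn_def]
      have hαα : s ^ α * s ^ (-α) = 1 := by
        rw [Real.rpow_neg hs.le, mul_inv_cancel₀ (Real.rpow_pos_of_pos hs α).ne']
      calc β * Real.exp (-(β * s)) * s ^ α * (s ^ (-α) * m s)
          = β * Real.exp (-(β * s)) * (s ^ α * s ^ (-α)) * m s := by ring
        _ = β * Real.exp (-(β * s)) * m s := by rw [hαα, mul_one]
    · rw [hhn_out s hst, indicator_of_notMem (fun h => hst (mem_Iic.mp h)), mul_zero]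
  have i_w0 : IntegrableOn (fun s : ℝ => β * Real.exp (-(β * s))) (Ioi 0) :=
    (integrableOn_weight hβ (a := 0) (by norm_num)).congr_fun (fun s _ => by simp only [Real.rpow_zero, mul_one]) measurableSet_Ioi
  have i_w1 : IntegrableOn (fun s : ℝ => β * Real.exp (-(β * s)) * s) (Ioi 0) :=
    (integrableOn_weight hβ (a := 1) (by norm_num)).congr_fun (fun s _ => by simp only [Real.rpow_one]) measurableSet_Ioi
  have hDi : Integrable (fun ω => Real.exp (-(β * F ω))) μ := by
    refine Integrable.of_bound (hF.const_mul β).neg.exp.aestronglyMeasurable 1 (ae_of_all _ fun ω => ?_)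
    rw [Real.norm_eq_abs, Real.abs_exp]
    exact Real.exp_le_one_iff.mpr (by have := hF0 ω; nlinarith)
  have hD : 0 < ∫ ω, Real.exp (-(β * F ω)) ∂μ := integral_exp_pos hDi
  rw [div_le_iff₀ hD, show α + ε + η * (1 + α) / (1 - η) = α + (ε + η') by rw [hη']; ring]
  rw [integral_mul_exp_neg_mul_eq_integral_cdf μ hF hF0 hβ, integral_exp_neg_mul_eq_integral_cdf μ hF hF0 hβ]
  have i_Dm : IntegrableOn (fun s : ℝ => β * Real.exp (-(β * s)) * m s) (Ioi 0) := by
    refine Integrable.mono' i_w0 ((measurable_const.mul (measurable_const.mul measurable_id).neg.exp).mul hm_meas).aestronglyMeasurable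
      (ae_of_all _ fun s => ?_)
    rw [Real.norm_eq_abs, abs_mul, abs_of_nonneg (by positivity : (0:ℝ) ≤ β * Real.exp (-(β * s))), abs_of_nonneg (hm0 s)]
    exact mul_le_of_le_one_right (by positivity) (hm1 s)
  have i_Nm : IntegrableOn (fun s : ℝ => (β * s - 1) * Real.exp (-(β * s)) * m s) (Ioi 0) := by
    have hb : IntegrableOn (fun s : ℝ => β * Real.exp (-(β * s)) * s + β⁻¹ * (β * Real.exp (-(β * s)))) (Ioi 0) :=
      i_w1.add (i_w0.const_mul _)
    refine Integrable.mono' hb ((((measurable_const.mul measurable_id).sub_const 1).mul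
      (measurable_const.mul measurable_id).neg.exp).mul hm_meas).aestronglyMeasurable ?_
    filter_upwards [ae_restrict_mem measurableSet_Ioi] with s hs
    have hs' : (0:ℝ) < s := hs
    rw [Real.norm_eq_abs, abs_mul, abs_of_nonneg (hm0 s)]
    have hexp : 0 < Real.exp (-(β * s)) := Real.exp_pos _
    have h1 : |β * s - 1| ≤ β * s + 1 := by
      calc |β * s - 1| ≤ |β * s| + |1| := abs_sub _ _
        _ = β * s + 1 := by rw [abs_of_nonneg (by positivity), abs_one]
    calc |(β * s - 1) * Real.exp (-(β * s))| * m s ≤ |(β * s - 1) * Real.exp (-(β * s))| * 1 :=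
          mul_le_mul_of_nonneg_left (hm1 s) (abs_nonneg _)
      _ = |β * s - 1| * Real.exp (-(β * s)) := by rw [mul_one, abs_mul, abs_of_pos hexp]
      _ ≤ (β * s + 1) * Real.exp (-(β * s)) := mul_le_mul_of_nonneg_right h1 hexp.le
      _ = β * Real.exp (-(β * s)) * s + β⁻¹ * (β * Real.exp (-(β * s))) := by field_simp
  have hφ : β * (∫ s in Ioi (0:ℝ), (β * s - 1) * Real.exp (-(β * s)) * m s) -
      (α + (ε + η')) * (∫ s in Ioi (0:ℝ), β * Real.exp (-(β * s)) * m s) =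
      ∫ s in Ioi (0:ℝ), β * Real.exp (-(β * s)) * (β * s - A) * m s := by
    rw [← integral_const_mul, ← integral_const_mul, ← integral_sub (i_Nm.const_mul β) (i_Dm.const_mul _)]
    refine setIntegral_congr_fun measurableSet_Ioi (fun s _ => ?_)
    rw [hA]; ring
  suffices key : ∫ s in Ioi (0:ℝ), β * Real.exp (-(β * s)) * (β * s - A) * m s ≤ 0 by linarith
  -- ### the key estimate
  -- integrability of `g hn`, `g (βs − (1+α)) hn`, then of `g h`, `g (βs − (1+α)) h` by domination, and of `g (βs − (1+α))`
  have i_ghn : IntegrableOn (fun s => g s * hn s) (Ioi 0) := by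
    have hb : IntegrableOn (fun s : ℝ => (Iic t₀).indicator (fun s => β * Real.exp (-(β * s)) * m s) s) (Ioi 0) :=
      i_Dm.indicator measurableSet_Iic
    exact hb.congr_fun (fun s hs => (hghn s hs).symm) measurableSet_Ioi
  have i_indf : IntegrableOn (fun s : ℝ => (Iic t₀).indicator (fun s => β * Real.exp (-(β * s)) * (β * s - (1 + α)) * m s) s) (Ioi 0) := by
    have hb : IntegrableOn (fun s : ℝ => β * Real.exp (-(β * s)) * (β * s - (1 + α)) * m s) (Ioi 0) := by
      have h1 : IntegrableOn (fun s : ℝ => β * (β * Real.exp (-(β * s)) * s) + (1 + α) * (β * Real.exp (-(β * s)))) (Ioi 0) :=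
        (i_w1.const_mul β).add (i_w0.const_mul _)
      refine Integrable.mono' h1 ((((measurable_const.mul (measurable_const.mul measurable_id).neg.exp).mul
        ((measurable_const.mul measurable_id).sub_const (1 + α))).mul hm_meas).aestronglyMeasurable) ?_
      filter_upwards [ae_restrict_mem measurableSet_Ioi] with s hs
      have hs' : (0:ℝ) < s := hs
      have hw : 0 ≤ β * Real.exp (-(β * s)) := by positivity
      rw [Real.norm_eq_abs, abs_mul, abs_mul, abs_of_nonneg hw, abs_of_nonneg (hm0 s)]
      have h1 : |β * s - (1 + α)| ≤ β * s + (1 + α) := by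
        calc |β * s - (1 + α)| ≤ |β * s| + |1 + α| := abs_sub _ _
          _ = β * s + (1 + α) := by rw [abs_of_nonneg (by positivity), abs_of_nonneg hA1]
      calc β * Real.exp (-(β * s)) * |β * s - (1 + α)| * m s ≤ β * Real.exp (-(β * s)) * |β * s - (1 + α)| * 1 :=
            mul_le_mul_of_nonneg_left (hm1 s) (mul_nonneg hw (abs_nonneg _))
        _ ≤ β * Real.exp (-(β * s)) * (β * s + (1 + α)) := by rw [mul_one]; exact mul_le_mul_of_nonneg_left h1 hw
        _ = β * (β * Real.exp (-(β * s)) * s) + (1 + α) * (β * Real.exp (-(β * s))) := by ring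
    exact hb.indicator measurableSet_Iic
  have hgfhn : ∀ s, 0 < s → g s * ((β * s - (1 + α)) * hn s) =
      (Iic t₀).indicator (fun s => β * Real.exp (-(β * s)) * (β * s - (1 + α)) * m s) s := fun s hs => by
    have e : g s * ((β * s - (1 + α)) * hn s) = (β * s - (1 + α)) * (g s * hn s) := by ring
    rw [e, hghn s hs]
    by_cases hst : s ≤ t₀
    · rw [indicator_of_mem (mem_Iic.mpr hst), indicator_of_mem (mem_Iic.mpr hst)]; ring
    · rw [indicator_of_notMem (fun h => hst (mem_Iic.mp h)), indicator_of_notMem (fun h => hst (mem_Iic.mp h)), mul_zero]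
  have i_gfhn : IntegrableOn (fun s => g s * ((β * s - (1 + α)) * hn s)) (Ioi 0) :=
    i_indf.congr_fun (fun s hs => (hgfhn s hs).symm) measurableSet_Ioi
  have i_gf : IntegrableOn (fun s => g s * (β * s - (1 + α))) (Ioi 0) := by
    refine integrableOn_of_le_K (C := β + (1 + α)) hβ hα0 (hgm.mul ((measurable_const.mul measurable_id).sub_const (1 + α)))
      fun s hs => ?_
    exact dom_core' hβ hs (linear_abs_le hβ hA1 hs (le_refl (0:ℝ)) zero_le_one).1
  -- the majorant-based products are a.e.-measurable on `(0,∞)` (antitone `h`) and dominated by `1/(1−η)` times the `hn` versions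
  have hh_aem : AEMeasurable h (volume.restrict (Ioi (0:ℝ))) := aemeasurable_restrict_of_antitoneOn measurableSet_Ioi hh_anti
  have hf_m : Measurable (fun s : ℝ => β * s - (1 + α)) := (measurable_const.mul measurable_id).sub_const (1 + α)
  have i_gh : IntegrableOn (fun s => g s * h s) (Ioi 0) := by
    refine Integrable.mono' (i_ghn.const_mul (1 / (1 - η))) (hgm.aemeasurable.mul hh_aem).aestronglyMeasurable ?_
    filter_upwards [ae_restrict_mem measurableSet_Ioi] with s hs
    have hs' : (0:ℝ) < s := hs
    have hg0 := hg_nonneg s hs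
    rw [Real.norm_eq_abs, abs_mul, abs_of_nonneg hg0, abs_of_nonneg (hh_nonneg s hs')]
    calc g s * h s ≤ g s * (hn s / (1 - η)) := mul_le_mul_of_nonneg_left (hh_le_hn s hs') hg0
      _ = 1 / (1 - η) * (g s * hn s) := by ring
  have i_gfh : IntegrableOn (fun s => g s * ((β * s - (1 + α)) * h s)) (Ioi 0) := by
    refine Integrable.mono' ((i_gfhn.const_mul (1 / (1 - η))).abs)
      (hgm.aemeasurable.mul (hf_m.aemeasurable.mul hh_aem)).aestronglyMeasurable ?_
    filter_upwards [ae_restrict_mem measurableSet_Ioi] with s hs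
    have hs' : (0:ℝ) < s := hs
    have hg0 := hg_nonneg s hs
    rw [Real.norm_eq_abs]
    have e1 : |g s * ((β * s - (1 + α)) * h s)| = g s * |β * s - (1 + α)| * h s := by
      rw [show g s * ((β * s - (1 + α)) * h s) = (g s * h s) * (β * s - (1 + α)) by ring,
        abs_mul (g s * h s) (β * s - (1 + α)), abs_of_nonneg (mul_nonneg hg0 (hh_nonneg s hs'))]
      ring
    have e2 : |1 / (1 - η) * (g s * ((β * s - (1 + α)) * hn s))| = 1 / (1 - η) * (g s * |β * s - (1 + α)| * hn s) := by
      rw [show 1 / (1 - η) * (g s * ((β * s - (1 + α)) * hn s)) = (1 / (1 - η) * (g s * hn s)) * (β * s - (1 + α)) by ring,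
        abs_mul (1 / (1 - η) * (g s * hn s)) (β * s - (1 + α)),
        abs_of_nonneg (mul_nonneg (by positivity : (0:ℝ) ≤ 1 / (1 - η)) (mul_nonneg hg0 (hhn_nonneg s hs')))]
      ring
    rw [e1, e2]
    calc g s * |β * s - (1 + α)| * h s ≤ g s * |β * s - (1 + α)| * (hn s / (1 - η)) :=
          mul_le_mul_of_nonneg_left (hh_le_hn s hs') (mul_nonneg hg0 (abs_nonneg _))
      _ = 1 / (1 - η) * (g s * |β * s - (1 + α)| * hn s) := by ring
  -- the majorant
  set M : ℝ → ℝ := fun s => g s * ((β * s - (1 + α)) * h s) - ε * (g s * hn s) +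
    (Ioi t₀).indicator (fun s => β * (β * s) * Real.exp (-(β * s))) s with hM
  have i_tail : IntegrableOn (fun s : ℝ => β * (β * s) * Real.exp (-(β * s))) (Ioi 0) := by
    have h : IntegrableOn (fun s : ℝ => β * (β * Real.exp (-(β * s)) * s)) (Ioi 0) := i_w1.const_mul β
    exact h.congr_fun (fun s _ => by ring) measurableSet_Ioi
  have i_M : IntegrableOn M (Ioi 0) :=
    (i_gfh.sub (i_ghn.const_mul ε)).add (i_tail.indicator measurableSet_Ioi)
  have i_φm : IntegrableOn (fun s : ℝ => β * Real.exp (-(β * s)) * (β * s - A) * m s) (Ioi 0) := by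
    have h : IntegrableOn (fun s : ℝ => β * ((β * s - 1) * Real.exp (-(β * s)) * m s) -
        (α + (ε + η')) * (β * Real.exp (-(β * s)) * m s)) (Ioi 0) := (i_Nm.const_mul β).sub (i_Dm.const_mul (α + (ε + η')))
    exact h.congr_fun (fun s _ => by rw [hA]; ring) measurableSet_Ioi
  -- pointwise comparison
  have hpt : ∀ s ∈ Ioi (0:ℝ), β * Real.exp (-(β * s)) * (β * s - A) * m s ≤ M s := by
    intro s hs
    have hs' : (0:ℝ) < s := hs
    have hw : 0 ≤ β * Real.exp (-(β * s)) := by positivity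
    have hg0 := hg_nonneg s hs
    by_cases hst : s ≤ t₀
    · -- inside `(0, t₀]`: `g f n ≤ g f N + η' g n`, then subtract `(ε + η') g n`
      have hind : (Ioi t₀).indicator (fun s => β * (β * s) * Real.exp (-(β * s))) s = 0 :=
        indicator_of_notMem (fun h => not_lt.mpr hst (mem_Ioi.mp h)) _
      -- `φ m = g (βs − A) n` with `g n = βe^{−βs} m`
      have hgn : g s * hn s = β * Real.exp (-(β * s)) * m s := by rw [hghn s hs', indicator_of_mem (mem_Iic.mpr hst)]
      have e0 : β * Real.exp (-(β * s)) * (β * s - A) * m s =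
          (β * s - (1 + α)) * (g s * hn s) - (ε + η') * (g s * hn s) := by rw [hgn, hA]; ring
      -- the defect `(βs − (1+α))·(hn − h) ≤ (1+α)(h − hn) ≤ η' · hn`
      have hd0 : 0 ≤ h s - hn s := sub_nonneg.mpr (hhn_le_h s hs')
      have hd1 : h s - hn s ≤ η / (1 - η) * hn s := by
        have := hh_le_hn s hs'
        have e : η / (1 - η) * hn s = hn s / (1 - η) - hn s := by field_simp; ring
        rw [e]; linarith
      have hdef : (β * s - (1 + α)) * (hn s - h s) ≤ (1 + α) * (h s - hn s) := by
        have e : (β * s - (1 + α)) * (hn s - h s) = (1 + α) * (h s - hn s) - β * s * (h s - hn s) := by ring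
        rw [e]
        have : 0 ≤ β * s * (h s - hn s) := mul_nonneg (by positivity) hd0
        linarith
      have hdef' : (β * s - (1 + α)) * (hn s - h s) ≤ η' * hn s := by
        calc (β * s - (1 + α)) * (hn s - h s) ≤ (1 + α) * (h s - hn s) := hdef
          _ ≤ (1 + α) * (η / (1 - η) * hn s) := mul_le_mul_of_nonneg_left hd1 hA1
          _ = η' * hn s := by rw [hη']; ring
      have hstep : (β * s - (1 + α)) * (g s * hn s) ≤ g s * ((β * s - (1 + α)) * h s) + η' * (g s * hn s) := by
        have e : (β * s - (1 + α)) * (g s * hn s) - (g s * ((β * s - (1 + α)) * h s) + η' * (g s * hn s)) =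
            g s * ((β * s - (1 + α)) * (hn s - h s) - η' * hn s) := by ring
        have hneg : (β * s - (1 + α)) * (hn s - h s) - η' * hn s ≤ 0 := by linarith
        have := mul_nonpos_of_nonneg_of_nonpos hg0 hneg
        linarith
      rw [hM]; dsimp only
      rw [hind, add_zero, e0]
      linarith
    · -- beyond `t₀`: `φ m ≤ β² s e^{−βs}`
      have hst' : t₀ < s := lt_of_not_ge hst
      have hind : (Ioi t₀).indicator (fun s => β * (β * s) * Real.exp (-(β * s))) s = β * (β * s) * Real.exp (-(β * s)) :=
        indicator_of_mem (mem_Ioi.mpr hst') _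
      rw [hM]; dsimp only; rw [hind, hh_out s hst, hhn_out s hst]
      simp only [mul_zero, sub_zero, zero_add]
      have h1 : β * Real.exp (-(β * s)) * (β * s - A) * m s ≤ β * Real.exp (-(β * s)) * (β * s) * m s := by
        have h0 : 0 ≤ β * Real.exp (-(β * s)) * A * m s := mul_nonneg (mul_nonneg hw hA0) (hm0 s)
        have e : β * Real.exp (-(β * s)) * (β * s - A) * m s =
            β * Real.exp (-(β * s)) * (β * s) * m s - β * Real.exp (-(β * s)) * A * m s := by ring
        linarith
      have h2 : β * Real.exp (-(β * s)) * (β * s) * m s ≤ β * Real.exp (-(β * s)) * (β * s) :=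
        mul_le_of_le_one_right (by positivity) (hm1 s)
      calc β * Real.exp (-(β * s)) * (β * s - A) * m s ≤ β * Real.exp (-(β * s)) * (β * s) := h1.trans h2
        _ = β * (β * s) * Real.exp (-(β * s)) := by ring
  have hint_le : ∫ s in Ioi (0:ℝ), β * Real.exp (-(β * s)) * (β * s - A) * m s ≤ ∫ s in Ioi (0:ℝ), M s :=
    setIntegral_mono_on i_φm i_M measurableSet_Ioi hpt
  -- ### evaluate / bound `∫ M`
  set Hn : ℝ := ∫ s in Ioi (0:ℝ), g s * hn s with hHn
  have hM_int : ∫ s in Ioi (0:ℝ), M s = (∫ s in Ioi (0:ℝ), g s * ((β * s - (1 + α)) * h s)) - ε * Hn +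
      (β * t₀ + 1) * Real.exp (-(β * t₀)) := by
    have i12 : IntegrableOn (fun s => g s * ((β * s - (1 + α)) * h s) - ε * (g s * hn s)) (Ioi 0) := i_gfh.sub (i_ghn.const_mul ε)
    have iind : IntegrableOn (fun s : ℝ => (Ioi t₀).indicator (fun s => β * (β * s) * Real.exp (-(β * s))) s) (Ioi 0) :=
      i_tail.indicator measurableSet_Ioi
    rw [hM]; dsimp only
    rw [integral_add i12 iind, integral_sub i_gfh (i_ghn.const_mul ε), integral_const_mul,
      setIntegral_indicator measurableSet_Ioi, Ioi_inter_Ioi, show (0:ℝ) ⊔ t₀ = t₀ from max_eq_right ht₀.le,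
      integral_Ioi_sq_mul_exp hβ ht₀.le]
  -- Chebyshev with the antitone majorant: `∫ g (βs−(1+α)) h ≤ 0` since the first moment vanishes
  have hfmono : MonotoneOn (fun s : ℝ => β * s - (1 + α)) (Ioi 0) := fun x _ y _ hxy => by
    have := mul_le_mul_of_nonneg_left hxy hβ.le
    simp only; linarith
  have cheb := chebyshev_weighted measurableSet_Ioi hg_nonneg hgm hgi hfmono hh_anti i_gf i_gh i_gfh
  have hmom1 : ∫ s in Ioi (0:ℝ), g s * (β * s - (1 + α)) = 0 := by
    have h := integral_linear_mul_weight hβ hαm1 (1 + α)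
    rw [hg]
    rw [show (∫ s in Ioi (0:ℝ), β * Real.exp (-(β * s)) * s ^ α * (β * s - (1 + α))) =
        ∫ s in Ioi (0:ℝ), (β * s - (1 + α)) * (β * Real.exp (-(β * s)) * s ^ α) from
        setIntegral_congr_fun measurableSet_Ioi (fun s _ => by ring), h]
    ring
  have hX1 : ∫ s in Ioi (0:ℝ), g s * ((β * s - (1 + α)) * h s) ≤ 0 := by
    rw [hmom1, zero_mul] at cheb
    refine le_of_not_gt fun hcon => ?_
    have : 0 < (∫ s in Ioi (0:ℝ), g s * ((β * s - (1 + α)) * h s)) * (∫ s in Ioi (0:ℝ), g s) := mul_pos hcon hG0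
    linarith
  -- the floor `Hn ≥ (1−η) m₁ t₀^{−α} e^{−2} β^{−α}`
  have hfloorH : (1 - η) * (t₀ ^ (-α) * m₁) * (Real.exp (-2) * β ^ (-α)) ≤ Hn := by
    have hsub : Ioc (0:ℝ) t₀ ⊆ Ioi 0 := Ioc_subset_Ioi_self
    have hgi' : IntegrableOn g (Ioc 0 t₀) := hgi.mono_set hsub
    have h1 : (1 - η) * (t₀ ^ (-α) * m₁) * (Real.exp (-2) * β ^ (-α)) ≤ ∫ s in Ioc (0:ℝ) t₀, g s * ((1 - η) * (t₀ ^ (-α) * m₁)) := by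
      rw [integral_mul_const, mul_comm]
      exact mul_le_mul_of_nonneg_right (by rw [hg]; exact weight_floor hβ hα0.le h2β)
        (mul_nonneg h1η.le (mul_nonneg (Real.rpow_nonneg ht₀.le _) hm₁.le))
    have h2 : ∫ s in Ioc (0:ℝ) t₀, g s * ((1 - η) * (t₀ ^ (-α) * m₁)) ≤ ∫ s in Ioc (0:ℝ) t₀, g s * hn s := by
      refine setIntegral_mono_on (hgi'.mul_const _) (i_ghn.mono_set hsub) measurableSet_Ioc fun s hs => ?_
      exact mul_le_mul_of_nonneg_left (hh_floor s hs.1 hs.2) (hg_nonneg s (hsub hs))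
    have h3 : ∫ s in Ioc (0:ℝ) t₀, g s * hn s ≤ Hn := by
      rw [hHn]
      refine setIntegral_mono_set i_ghn ?_ (Eventually.of_forall hsub)
      filter_upwards [ae_restrict_mem measurableSet_Ioi] with s hs using mul_nonneg (hg_nonneg s hs) (hhn_nonneg s hs)
    exact h1.trans (h2.trans h3)
  -- the tail against the floor
  have htail : (β * t₀ + 1) * Real.exp (-(β * t₀)) ≤ ε * ((1 - η) * (t₀ ^ (-α) * m₁) * (Real.exp (-2) * β ^ (-α))) := by
    have hX0 : 0 < β * t₀ := mul_pos hβ ht₀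
    have hXα : 0 < (β * t₀) ^ α := Real.rpow_pos_of_pos hX0 α
    have hneg : (β * t₀) ^ (-α) = ((β * t₀) ^ α)⁻¹ := Real.rpow_neg hX0.le α
    have hsplit : t₀ ^ (-α) * β ^ (-α) = (β * t₀) ^ (-α) := by
      rw [Real.mul_rpow hβ.le ht₀.le]; ring
    have hexp : Real.exp (2 - β * t₀) = Real.exp (-(β * t₀)) * (Real.exp (-2))⁻¹ := by
      rw [← Real.exp_neg, neg_neg, ← Real.exp_add]; ring_nf
    have key : (β * t₀ + 1) * Real.exp (-(β * t₀)) * ((β * t₀) ^ α * (Real.exp (-2))⁻¹) ≤ ε * ((1 - η) * m₁) := by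
      calc (β * t₀ + 1) * Real.exp (-(β * t₀)) * ((β * t₀) ^ α * (Real.exp (-2))⁻¹)
          = (β * t₀ + 1) * (β * t₀) ^ α * Real.exp (2 - β * t₀) := by rw [hexp]; ring
        _ ≤ ε * ((1 - η) * m₁) := hthr
    have hc0 : 0 < (β * t₀) ^ α * (Real.exp (-2))⁻¹ := mul_pos hXα (inv_pos.mpr (Real.exp_pos _))
    rw [← le_div_iff₀ hc0] at key
    refine key.trans (le_of_eq ?_)
    rw [show (1 - η) * (t₀ ^ (-α) * m₁) * (Real.exp (-2) * β ^ (-α)) = (1 - η) * m₁ * Real.exp (-2) * (t₀ ^ (-α) * β ^ (-α)) by ring,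
      hsplit, hneg]
    field_simp
  -- conclude
  calc ∫ s in Ioi (0:ℝ), β * Real.exp (-(β * s)) * (β * s - A) * m s ≤ ∫ s in Ioi (0:ℝ), M s := hint_le
    _ = (∫ s in Ioi (0:ℝ), g s * ((β * s - (1 + α)) * h s)) - ε * Hn + (β * t₀ + 1) * Real.exp (-(β * t₀)) := hM_int
    _ ≤ 0 - ε * ((1 - η) * (t₀ ^ (-α) * m₁) * (Real.exp (-2) * β ^ (-α))) +
          ε * ((1 - η) * (t₀ ^ (-α) * m₁) * (Real.exp (-2) * β ^ (-α))) := by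
        have h1 := mul_le_mul_of_nonneg_left hfloorH hε.le
        linarith
    _ = 0 := by ring

end Summit.QuantumFields.YangMills.Theorems.VirialFluxGap.ScalingTauber

end
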